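import Mathlib

/-!
# Disproof of `NoStableSection` — findings (cdisprove refuter, crux stmt-PneNP-2462, cycle 1)

Crux: `Summit.PneNP.PneNP.Theses.OverlapGapAlgebra.NoStableSection` — Bresler–Huang's ensemble
multi-OGP for random k-SAT (arXiv:2106.02129, Thm 2.6 via Props 4.6–4.7, §5) read for an ARBITRARY
section `g : Inst → assignment`: `∃ k₀ ∀ k ≥ k₀ ∃ η ν c > 0 ∀ᶠ n ∀ g`, the paths `Ψ` (k+1 i.i.d. literal
arrays, spliced literal-by-literal, `k` sweeps) on which `g` is `ν`-valid at all `k·mk+1` splice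
points and moves `≤ ηn` per step are a fraction `≤ e^{-cn}`.

## Verdict of this cycle: NO KILL — the crux is (the interior of) a printed theorem, faithfully typed

* Read back symbol by symbol (probe `W.lean` importing the route file, rc 0; `NoStableSection ↔
  ∃ k₀, ∀ k ≥ k₀, Inner k` is `Iff.rfl` there): `m = ⌊5·2^k·log k/k·n⌋₊` (natural log, so
  κ = 5 > κ* ≈ 4.911); `P r q` = BH Def 4.2 splice (positions `a·k+b < q` from `Ψ (r+1)`), connected
  across sweeps (`P r (mk) = P (r+1) 0`); validity = `#{i : ∀ j, g(P)(var) ≠ sign} ≤ νm` = at most `νm`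
  violated clauses (literal `(v,b)` true iff `σ v = b`); stability = `hammingDist ≤ ηn` for `q < mk`.
  No junk operator bites: `ℕ`-floor of a nonnegative real, `k ≥ k₀` chosen by the prover (so
  `log k > 0`, `m > 0` eventually), `η, ν, c` existential AFTER `k` (the weakest, BH-compatible
  order: BH take `η = (β⁺-β⁻)/(8k)`, `ν = 1/(k²2^k)`; smaller `η, ν` only shrink the event).
* Why every cheap attack fails (each is a theorem below or a computation):
  - constant / majority-vote sections: stable, but `ν`-validity at even ONE instance is a large
    deviation `P(Bin(m,2^{-k}) ≤ νm) = e^{-Θ(m)}` once the prover takes `ν < 2^{-k}` — consistent with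
    `∃ c`. (They DO show the scale `e^{-cn}` is right: `not_forallRate`.)
  - near-solution choosers (argmin `violCount`, lexicographic-first solution): valid w.h.p. but this
    is exactly the forbidden structure; BH Prop 4.6 is deterministic given the event's own
    `ηn`-stability, Prop 4.7(iii) (`S_ogp`) is `g`-free, and Prop 4.7(ii) (`S_indep`) uses only that
    `x^t` is a function of `Φ^t` plus `Φ^{t+km} ⊥ Φ^{≤t}` (re-read on the text, p.15–16): the
    ∀-`g` reading is sound.
  - small widths: for `2 ≤ k ≤ 22` the density `5·2^k log k/k` exceeds the satisfiability threshold
    (`5 log k/k > log 2`), so formulas are `ν`-far from satisfiable w.h.p. and the body holds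
    trivially for small `ν`; only `k = 0, 1` (`m = 0`) FAIL (`inner_zero_false`, `inner_one_false`),
    which `∃ k₀` absorbs.
  - barrier catalogue (`Literature/Barriers/PneNP/*`): relativization / natural proofs / algebrization
    / low-degree counterexamples do not bear on a pure probability statement about random paths.
* Line `DartGame` (lead prover-line-stmt-PneNP-2462-0): stubs A (ladder), B (entropy toolkit),
  C (cond-entropy counting), E (path validity, BH Lemma 5.3), F (the one Fubini split, BH 4.7(ii))
  and the small-ball lemma are LANDED (p103249, p104243, p104245, p104291, p104237, p103846 — all
  ACCEPTED, standard axioms); the glue is sorry-free in `Lines/DartGame.lean`. The ONLY open stub is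
  `EnergyBound` (+ helper `stub_energyRungAbstract`). I tried to break both and could not — their
  derivations check line by line (see `-- Line DartGame` below) and a brute-force numeric scan
  (`energy_check.py`, n ≤ 8, k ≤ 4, random + hill-climbing adversarial `Y`) finds slack ≥ 1.07, never
  a violation. No `stub-false` / `stub-misstated` finding to post.

## Contents (all sorry-free, standard axioms; mirrored for landing in
`Theorems/NoStableSection/Negative/NoStableSectionFalseVariants.lean`, names `NoStableSectionAt`,
`NoStableSectionWithoutValid`, `NoStableSectionForallRate`)

* `Inner k` / `noStableSection_iff` — the body at fixed width; `inner_zero_false`, `inner_one_false`,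
  `not_forall_inner`: the strengthening `k₀ = 0` is FALSE (degenerate `m = 0`).
* (a) load-bearing: `WithoutValid` / `noStableSection_false_without_valid` — drop ν-validity ⇒ false
  (constant section).
* (a') load-bearing modulo H: `WithoutConsec` / `NearSatWhp` /
  `noStableSection_false_without_consec_of_nearSat` — drop STABILITY ⇒ false provided random k-SAT
  at density `α_k` is `ν`-near-satisfiable w.h.p. with a polynomial rate (H = `NearSatWhp k` for
  large `k`: Achlioptas–Peres 2004 Thm 2 + Azuma; in print, not in the tree). Engine: the splice
  maps `Ψ ↦ P r q` have uniform fibres (`card_filter_splice_mem`, via the involution `swapAt`),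
  so `#{Ψ : P r q Ψ ∈ B} = #B·#Inst^k` and a union bound over the `k(mk+1)` splice points applies.
* (b) tightness: `ForallRate` / `not_forallRate` — `∀ c` (super-exponential) is FALSE; the event of
  the constant-`true` section has probability `≥ 2^{-k·m·(k+1)} ≥ e^{-(k(k+1)α_k log 2)n}`, so any
  admissible rate obeys `c ≤ k(k+1)·α_k·log 2` — `c` must depend on `k` (BH's rate is
  `Θ((κ-β⁺) log k/k)`, far below this ceiling; the true exponent is open).
* `-- Line DartGame`: audit notes on `EnergyBound` / `stub_energyRungAbstract` (comments only).
-/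

namespace Summit.PneNP.PneNP.Cruxes.NoStableSection.Disproof

set_option linter.dupNamespace false

open Finset Real Filter

/-- The crux's body at a FIXED clause width `k` (so that `NoStableSection ↔ ∃ k₀, ∀ k ≥ k₀, Inner k`,
see `noStableSection_iff`). Verbatim the text of the route decl after `∀ k ≥ k₀,`. -/
def Inner (k : ℕ) : Prop :=
  ∃ η : ℝ, 0 < η ∧ ∃ ν : ℝ, 0 < ν ∧ ∃ c : ℝ, 0 < c ∧ ∀ᶠ n : ℕ in Filter.atTop, ∀ m : ℕ, m = ⌊5 * 2 ^ k * Real.log k / k * n⌋₊ → ∀ g : (Fin m → Fin k → Fin n × Bool) → (Fin n → Bool), ((Finset.univ.filter fun Ψ : Fin (k + 1) → Fin m → Fin k → Fin n × Bool => let P : Fin k → ℕ → Fin m → Fin k → Fin n × Bool := fun r q a b => if (a : ℕ) * k + b < q then Ψ r.succ a b else Ψ r.castSucc a b; (∀ r : Fin k, ∀ q ≤ m * k, ((Finset.univ.filter fun i : Fin m => ∀ j, g (P r q) (P r q i j).1 ≠ (P r q i j).2).card : ℝ) ≤ ν * m) ∧ ∀ r : Fin k, ∀ q < m * k, (hammingDist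 (g (P r q)) (g (P r (q + 1))) : ℝ) ≤ η * n).card : ℝ) ≤ Real.exp (-(c * n)) * Fintype.card (Fin (k + 1) → Fin m → Fin k → Fin n × Bool)

/- NOTE (publication copy): this tree copy is Mathlib-only because the Lean farm has been
incoherent for `Summits.PneNP.PneNP.Theses.OverlapGapAlgebra` since the 13:58Z route regeneration
(crux write rc 75 ×7). The folder/evidence copy (`run/gate/evidence/stmt-PneNP-2462/…-Disproof.lean`)
imports the route file and proves `noStableSection_iff : NoStableSection ↔ ∃ k₀, ∀ k ≥ k₀, Inner k`
by `Iff.rfl` — `Inner k` below is verbatim the route decl's text after `∃ k₀ : ℕ, ∀ k ≥ k₀,`. -/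

/-- Degenerate widths: at `k = 1` the density `5·2^k·log k/k` is `0` (`Real.log 1 = 0`), so `m = 0`,
the path space is a single point on which every `g` is trivially valid and stable, and the claimed
bound `1 ≤ e^{-cn}` fails. Hence `k₀ ≥ 2` is necessary (the strengthening `∀ k ≥ 1` is FALSE). -/
theorem inner_one_false : ¬ Inner 1 := by
  rintro ⟨η, hη, ν, hν, c, hc, hev⟩
  obtain ⟨N, hN⟩ := Filter.eventually_atTop.1 hev
  have hm : (0 : ℕ) = ⌊5 * 2 ^ (1 : ℕ) * Real.log ((1 : ℕ) : ℝ) / ((1 : ℕ) : ℝ) * ((max N 1 : ℕ) : ℝ)⌋₊ := by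
    simp
  have h := hN (max N 1) (le_max_left _ _) 0 hm (fun _ _ => true)
  simp at h
  exact absurd h (not_le.2 (mul_pos hc (lt_max_of_lt_right one_pos)))

/-- Same at `k = 0` (`Real.log 0 = 0`, `m = 0`). -/
theorem inner_zero_false : ¬ Inner 0 := by
  rintro ⟨η, hη, ν, hν, c, hc, hev⟩
  obtain ⟨N, hN⟩ := Filter.eventually_atTop.1 hev
  have hm : (0 : ℕ) = ⌊5 * 2 ^ (0 : ℕ) * Real.log ((0 : ℕ) : ℝ) / ((0 : ℕ) : ℝ) * ((max N 1 : ℕ) : ℝ)⌋₊ := by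
    simp
  have h := hN (max N 1) (le_max_left _ _) 0 hm (fun _ _ => true)
  simp at h
  exact absurd h (not_le.2 (mul_pos hc (lt_max_of_lt_right one_pos)))

/-- The natural strengthening "for every clause width" (`k₀ = 0`) of the crux is FALSE. -/
theorem not_forall_inner : ¬ ∀ k : ℕ, Inner k := fun h => inner_one_false (h 1)

/-! ## (a) Load-bearing hypotheses

### Validity is load-bearing: `NoStableSection` with the ν-validity conjunct DROPPED is false
(the constant section `g ≡ (fun _ => true)` never moves, so EVERY path is "stable"). -/

/-- The crux with the validity conjunct `∀ r, ∀ q ≤ m k, #violated ≤ ν m` deleted (only the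
`η n`-stability of consecutive outputs is kept). -/
def WithoutValid : Prop :=
  ∃ k₀ : ℕ, ∀ k ≥ k₀, ∃ η : ℝ, 0 < η ∧ ∃ c : ℝ, 0 < c ∧ ∀ᶠ n : ℕ in Filter.atTop, ∀ m : ℕ,
    m = ⌊5 * 2 ^ k * Real.log k / k * n⌋₊ →
    ∀ g : (Fin m → Fin k → Fin n × Bool) → (Fin n → Bool),
      ((Finset.univ.filter fun Ψ : Fin (k + 1) → Fin m → Fin k → Fin n × Bool =>
        let P : Fin k → ℕ → Fin m → Fin k → Fin n × Bool := fun r q a b =>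
          if (a : ℕ) * k + b < q then Ψ r.succ a b else Ψ r.castSucc a b
        ∀ r : Fin k, ∀ q < m * k, (hammingDist (g (P r q)) (g (P r (q + 1))) : ℝ) ≤ η * n).card : ℝ)
      ≤ Real.exp (-(c * n)) * Fintype.card (Fin (k + 1) → Fin m → Fin k → Fin n × Bool)

/-- **Any proof of the crux must use ν-validity**: without it the constant section is a
counterexample at every `k` (witness `g := fun _ _ => true`, Hamming movement `0 ≤ η n`; the event is
the whole path space, of positive cardinality, while `e^{-cn} < 1`). -/
theorem noStableSection_false_without_valid : ¬ WithoutValid := by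
  rintro ⟨k₀, h⟩
  obtain ⟨η, hη, c, hc, hev⟩ := h k₀ le_rfl
  obtain ⟨N, hN⟩ := Filter.eventually_atTop.1 hev
  set n : ℕ := max N 1 with hn
  have hn1 : 1 ≤ n := le_max_right _ _
  have h := hN n (le_max_left _ _) _ rfl (fun _ _ => true)
  have hηn : (0 : ℝ) ≤ η * n := by positivity
  simp only [hammingDist_self, Nat.cast_zero, hηn, implies_true, Finset.filter_true,
    Finset.card_univ] at h
  haveI : Nonempty (Fin n) := ⟨⟨0, hn1⟩⟩
  have hpos : (0 : ℝ) < Fintype.card (Fin (k₀ + 1) → Fin ⌊5 * 2 ^ k₀ * Real.log k₀ / k₀ * n⌋₊ →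
      Fin k₀ → Fin n × Bool) := by exact_mod_cast Fintype.card_pos
  have hexp : Real.exp (-(c * n)) < 1 := by
    rw [Real.exp_lt_one_iff]
    have : (1 : ℝ) ≤ n := by exact_mod_cast hn1
    nlinarith
  nlinarith

/-! ## (b) Tightness of the exponential scale

The bound `e^{-cn}` cannot be improved to a super-exponential one: the crux with `∃ c > 0` replaced
by `∀ c > 0` is FALSE. Witness: the constant section `g ≡ true` together with the ALL-POSITIVE
paths `Ψ s a b = (v, true)` (a `2^{-(k+1)·m·k}` fraction of the path space): every instance on such
a path has only positive literals, so `g` violates no clause and never moves. Hence for every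
`k ≥ 1` the event has probability `≥ 2^{-(k+1)mk} ≥ e^{-(k(k+1)·α_k·log 2)·n}`, `α_k = 5·2^k log k/k`:
the rate `c` of the crux is at most `k(k+1) α_k log 2` (it must depend on `k`). -/

/-- The crux with `∃ c > 0, ∀ᶠ n, …` strengthened to `∀ c > 0, ∀ᶠ n, …` (super-exponential decay). -/
def ForallRate : Prop :=
  ∃ k₀ : ℕ, ∀ k ≥ k₀, ∃ η : ℝ, 0 < η ∧ ∃ ν : ℝ, 0 < ν ∧ ∀ c : ℝ, 0 < c → ∀ᶠ n : ℕ in Filter.atTop, ∀ m : ℕ, m = ⌊5 * 2 ^ k * Real.log k / k * n⌋₊ → ∀ g : (Fin m → Fin k → Fin n × Bool) → (Fin n → Bool), ((Finset.univ.filter fun Ψ : Fin (k + 1) → Fin m → Fin k → Fin n × Bool => let P : Fin k → ℕ → Fin m → Fin k → Fin n × Bool := fun r q a b => if (a : ℕ) * k + b < q then Ψ r.succ a b else Ψ r.castSucc a b; (∀ r : Fin k, ∀ q ≤ m * k, ((Finset.univ.filter fun i : Fin m => ∀ j, g (P r q) (P r q i j).1 ≠ (P r q i j).2).card : ℝ)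 ≤ ν * m) ∧ ∀ r : Fin k, ∀ q < m * k, (hammingDist (g (P r q)) (g (P r (q + 1))) : ℝ) ≤ η * n).card : ℝ) ≤ Real.exp (-(c * n)) * Fintype.card (Fin (k + 1) → Fin m → Fin k → Fin n × Bool)

/-- **Tightness of the scale**: the super-exponential strengthening `ForallRate` is false. For
`k ≥ 1` and ANY `η, ν ≥ 0`, the all-positive paths (an injective image of
`Fin (k+1) → Fin m → Fin k → Fin n`) lie in the event of the constant-`true` section, so
`#event ≥ #paths / 2^{k·m·(k+1)}`, contradicting `#event ≤ e^{-cn} #paths` at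
`c := k(k+1)·α_k + 1 > k(k+1)·(m/n)·log 2`. -/
theorem not_forallRate : ¬ ForallRate := by
  rintro ⟨k₀, h⟩
  -- work at a width `k ≥ 1`
  set k : ℕ := max k₀ 1 with hkdef
  have hk1 : 1 ≤ k := le_max_right _ _
  obtain ⟨η, hη, ν, hν, hall⟩ := h k (le_max_left _ _)
  set α : ℝ := 5 * 2 ^ k * Real.log k / k with hα
  have hlog : 0 ≤ Real.log k := Real.log_nonneg (by exact_mod_cast hk1)
  have hα0 : 0 ≤ α := by rw [hα]; positivity
  set c : ℝ := α * (k * (k + 1)) + 1 with hc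
  have hc0 : 0 < c := by rw [hc]; positivity
  obtain ⟨N, hN⟩ := Filter.eventually_atTop.1 (hall c hc0)
  set n : ℕ := max N 1 with hn
  have hn1 : 1 ≤ n := le_max_right _ _
  set m : ℕ := ⌊α * n⌋₊ with hm
  have hmle : (m : ℝ) ≤ α * n := Nat.floor_le (by positivity)
  have hmain := hN n (le_max_left _ _) m (by rw [hm, hα]) (fun _ _ => true)
  -- the all-positive paths are in the event
  let e : (Fin (k + 1) → Fin m → Fin k → Fin n) → (Fin (k + 1) → Fin m → Fin k → Fin n × Bool) :=
    fun F s a b => (F s a b, true)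
  have he : Function.Injective e := by
    intro F G hFG
    funext s a b
    have := congrFun (congrFun (congrFun hFG s) a) b
    simpa [e] using this
  haveI : Nonempty (Fin k) := ⟨⟨0, hk1⟩⟩
  have hνm : (0 : ℝ) ≤ ν * m := by positivity
  have hηn : (0 : ℝ) ≤ η * n := by positivity
  have hsub : Finset.univ.image e ⊆ Finset.univ.filter fun Ψ : Fin (k + 1) → Fin m → Fin k → Fin n × Bool =>
      let P : Fin k → ℕ → Fin m → Fin k → Fin n × Bool := fun r q a b =>
        if (a : ℕ) * k + b < q then Ψ r.succ a b else Ψ r.castSucc a b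
      (∀ r : Fin k, ∀ q ≤ m * k, ((Finset.univ.filter fun i : Fin m => ∀ j,
        (fun (_ : Fin m → Fin k → Fin n × Bool) (_ : Fin n) => true) (P r q) (P r q i j).1 ≠
          (P r q i j).2).card : ℝ) ≤ ν * m) ∧
      ∀ r : Fin k, ∀ q < m * k, (hammingDist ((fun (_ : Fin m → Fin k → Fin n × Bool) (_ : Fin n) => true) (P r q))
        ((fun (_ : Fin m → Fin k → Fin n × Bool) (_ : Fin n) => true) (P r (q + 1))) : ℝ) ≤ η * n := by
    intro Ψ hΨ
    rw [Finset.mem_image] at hΨ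
    obtain ⟨F, -, rfl⟩ := hΨ
    rw [Finset.mem_filter]
    refine ⟨Finset.mem_univ _, ?_, ?_⟩
    · intro r q hq
      refine le_trans ?_ hνm
      have hz : ∀ s : Finset (Fin m), s = ∅ → ((s.card : ℕ) : ℝ) ≤ 0 := fun s hs => by simp [hs]
      apply hz
      rw [Finset.filter_eq_empty_iff]
      intro i _ hall'
      have := hall' ⟨0, hk1⟩
      apply this
      beta_reduce
      split <;> rfl
    · intro r q hq
      simp only [hammingDist_self, Nat.cast_zero]
      exact hηn
  have hcard_le : (Fintype.card (Fin (k + 1) → Fin m → Fin k → Fin n) : ℝ) ≤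
      ((Finset.univ.filter fun Ψ : Fin (k + 1) → Fin m → Fin k → Fin n × Bool =>
      let P : Fin k → ℕ → Fin m → Fin k → Fin n × Bool := fun r q a b =>
        if (a : ℕ) * k + b < q then Ψ r.succ a b else Ψ r.castSucc a b
      (∀ r : Fin k, ∀ q ≤ m * k, ((Finset.univ.filter fun i : Fin m => ∀ j,
        (fun (_ : Fin m → Fin k → Fin n × Bool) (_ : Fin n) => true) (P r q) (P r q i j).1 ≠
          (P r q i j).2).card : ℝ) ≤ ν * m) ∧
      ∀ r : Fin k, ∀ q < m * k, (hammingDist ((fun (_ : Fin m → Fin k → Fin n × Bool) (_ : Fin n) => true) (P r q))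
        ((fun (_ : Fin m → Fin k → Fin n × Bool) (_ : Fin n) => true) (P r (q + 1))) : ℝ) ≤ η * n).card : ℝ) := by
    have := Finset.card_le_card hsub
    rw [Finset.card_image_of_injective _ he, Finset.card_univ] at this
    exact_mod_cast this
  -- cardinalities of the two path spaces
  have hA : (Fintype.card (Fin (k + 1) → Fin m → Fin k → Fin n) : ℝ) = (((n : ℝ) ^ k) ^ m) ^ (k + 1) := by
    simp only [Fintype.card_fun, Fintype.card_fin]
    push_cast
    ring
  have hB : (Fintype.card (Fin (k + 1) → Fin m → Fin k → Fin n × Bool) : ℝ) =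
      (((n : ℝ) ^ k) ^ m) ^ (k + 1) * (2 : ℝ) ^ (k * m * (k + 1)) := by
    simp only [Fintype.card_fun, Fintype.card_fin, Fintype.card_prod, Fintype.card_bool]
    push_cast
    ring
  set A : ℝ := (((n : ℝ) ^ k) ^ m) ^ (k + 1) with hAdef
  have hApos : 0 < A := by positivity
  -- combine: A ≤ #event ≤ e^{-cn} · A · 2^{k m (k+1)}
  have h1 : A ≤ Real.exp (-(c * n)) * (A * (2 : ℝ) ^ (k * m * (k + 1))) := by
    rw [hA] at hcard_le
    rw [hB] at hmain
    exact hcard_le.trans hmain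
  have h2 : (1 : ℝ) ≤ Real.exp (-(c * n)) * (2 : ℝ) ^ (k * m * (k + 1)) := by
    by_contra hlt
    rw [not_le] at hlt
    have : Real.exp (-(c * n)) * (A * (2 : ℝ) ^ (k * m * (k + 1))) < A := by
      calc Real.exp (-(c * n)) * (A * (2 : ℝ) ^ (k * m * (k + 1)))
          = (Real.exp (-(c * n)) * (2 : ℝ) ^ (k * m * (k + 1))) * A := by ring
        _ < 1 * A := mul_lt_mul_of_pos_right hlt hApos
        _ = A := one_mul A
    linarith
  have h3 := Real.log_le_log one_pos h2
  rw [Real.log_one, Real.log_mul (Real.exp_pos _).ne' (by positivity), Real.log_exp,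
    Real.log_pow] at h3
  -- h3 : 0 ≤ -(c n) + (k m (k+1)) log 2
  have hlog2 : Real.log 2 ≤ 1 := by
    have := Real.log_le_sub_one_of_pos (by norm_num : (0 : ℝ) < 2)
    linarith
  have hkm : ((k * m * (k + 1) : ℕ) : ℝ) * Real.log 2 ≤ (k : ℝ) * (k + 1) * (α * n) := by
    have h' : ((k * m * (k + 1) : ℕ) : ℝ) = (k : ℝ) * (k + 1) * m := by push_cast; ring
    rw [h']
    have hkk : (0 : ℝ) ≤ (k : ℝ) * (k + 1) := by positivity
    calc (k : ℝ) * (k + 1) * m * Real.log 2 ≤ (k : ℝ) * (k + 1) * m * 1 :=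
          mul_le_mul_of_nonneg_left hlog2 (by positivity)
      _ = (k : ℝ) * (k + 1) * m := mul_one _
      _ ≤ (k : ℝ) * (k + 1) * (α * n) := mul_le_mul_of_nonneg_left hmle hkk
  have hn1' : (1 : ℝ) ≤ n := by exact_mod_cast hn1
  have hcn : c * n = α * (k * (k + 1)) * n + n := by rw [hc]; ring
  nlinarith

/-! ## (a') Stability is load-bearing — modulo near-satisfiability

Dropping the STABILITY conjunct instead: `WithoutConsec` is false PROVIDED random k-SAT at the
window density is `ν`-near-satisfiable with high probability (`NearSatWhp`, a printed theorem the
tree lacks). Unconditionally refuting `WithoutConsec` needs exactly such a fact for EVERY `ν > 0`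
(the prover picks `ν`), so this is the honest form: a kernel-checked reduction plus a precisely
stated hypothesis. The reduction's engine is the uniform-fibre lemma for the splice maps. -/

section Fiber

variable {k m n : ℕ}

/-- Swap, at the literal positions `a·k+b < q`, the entries of sweeps `r` and `r+1` of a path. -/
def swapAt (r : Fin k) (q : ℕ) (Ψ : Fin (k + 1) → Fin m → Fin k → Fin n × Bool) :
    Fin (k + 1) → Fin m → Fin k → Fin n × Bool :=
  fun s a b => if (a : ℕ) * k + b < q then
      (if s = r.castSucc then Ψ r.succ a b else if s = r.succ then Ψ r.castSucc a b else Ψ s a b)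
    else Ψ s a b

/-- `swapAt r q` is an involution. -/
theorem swapAt_swapAt (r : Fin k) (q : ℕ) (Ψ : Fin (k + 1) → Fin m → Fin k → Fin n × Bool) :
    swapAt r q (swapAt r q Ψ) = Ψ := by
  have hne : r.castSucc ≠ r.succ := ne_of_lt Fin.castSucc_lt_succ
  funext s a b
  by_cases h : (a : ℕ) * k + b < q
  · by_cases h1 : s = r.castSucc
    · subst h1
      simp [swapAt, h, hne.symm]
    · by_cases h2 : s = r.succ
      · subst h2
        simp [swapAt, h, hne.symm]
      · simp [swapAt, h, h1, h2]
  · simp [swapAt, h]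

/-- Sweep `r` of the swapped path is the splice point `(r, q)` of the original path. -/
theorem swapAt_castSucc (r : Fin k) (q : ℕ) (Ψ : Fin (k + 1) → Fin m → Fin k → Fin n × Bool) :
    swapAt r q Ψ r.castSucc =
      fun (a : Fin m) (b : Fin k) => if (a : ℕ) * k + b < q then Ψ r.succ a b else Ψ r.castSucc a b := by
  funext a b
  by_cases h : (a : ℕ) * k + b < q <;> simp [swapAt, h]

/-- `swapAt r q` as an involutive permutation of the path space. -/
def swapEquiv (r : Fin k) (q : ℕ) :
    (Fin (k + 1) → Fin m → Fin k → Fin n × Bool) ≃ (Fin (k + 1) → Fin m → Fin k → Fin n × Bool) where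
  toFun := swapAt r q
  invFun := swapAt r q
  left_inv := swapAt_swapAt r q
  right_inv := swapAt_swapAt r q

/-- Fibres of a coordinate projection of the path space are uniform. -/
theorem card_filter_apply_mem (r₀ : Fin (k + 1)) (B : Finset (Fin m → Fin k → Fin n × Bool)) :
    ((Finset.univ.filter fun Ψ : Fin (k + 1) → Fin m → Fin k → Fin n × Bool => Ψ r₀ ∈ B).card) =
      B.card * (Fintype.card (Fin m → Fin k → Fin n × Bool)) ^ k := by
  classical
  let e := (Fin.insertNthEquiv (fun _ : Fin (k + 1) => Fin m → Fin k → Fin n × Bool) r₀).symm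
  rw [Finset.card_equiv e (t := B ×ˢ (Finset.univ : Finset (Fin k → Fin m → Fin k → Fin n × Bool)))]
  · rw [Finset.card_product, Finset.card_univ, Fintype.card_fun, Fintype.card_fin]
  · intro Ψ
    simp [e]

/-- Fibres of the splice map `Ψ ↦ P r q` are uniform: `#{Ψ : P r q ∈ B} = #B · #Inst^k`. -/
theorem card_filter_splice_mem (r : Fin k) (q : ℕ) (B : Finset (Fin m → Fin k → Fin n × Bool)) :
    ((Finset.univ.filter fun Ψ : Fin (k + 1) → Fin m → Fin k → Fin n × Bool =>
        (fun (a : Fin m) (b : Fin k) => if (a : ℕ) * k + b < q then Ψ r.succ a b else Ψ r.castSucc a b) ∈ B).card) =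
      B.card * (Fintype.card (Fin m → Fin k → Fin n × Bool)) ^ k := by
  rw [← card_filter_apply_mem r.castSucc B]
  refine Finset.card_equiv (swapEquiv r q) (fun Ψ => ?_)
  simp only [Finset.mem_filter, Finset.mem_univ, true_and]
  change _ ↔ swapAt r q Ψ r.castSucc ∈ B
  rw [swapAt_castSucc]

end Fiber

section WithoutConsec

/-- The crux with the STABILITY conjunct `∀ r, ∀ q < m k, hammingDist ≤ η n` deleted (only
`ν`-validity at every splice point is kept). -/
def WithoutConsec : Prop :=
  ∃ k₀ : ℕ, ∀ k ≥ k₀, ∃ ν : ℝ, 0 < ν ∧ ∃ c : ℝ, 0 < c ∧ ∀ᶠ n : ℕ in Filter.atTop, ∀ m : ℕ,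
    m = ⌊5 * 2 ^ k * Real.log k / k * n⌋₊ →
    ∀ g : (Fin m → Fin k → Fin n × Bool) → (Fin n → Bool),
      ((Finset.univ.filter fun Ψ : Fin (k + 1) → Fin m → Fin k → Fin n × Bool =>
        let P : Fin k → ℕ → Fin m → Fin k → Fin n × Bool := fun r q a b =>
          if (a : ℕ) * k + b < q then Ψ r.succ a b else Ψ r.castSucc a b
        ∀ r : Fin k, ∀ q ≤ m * k, ((Finset.univ.filter fun i : Fin m =>
          ∀ j, g (P r q) (P r q i j).1 ≠ (P r q i j).2).card : ℝ) ≤ ν * m).card : ℝ)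
      ≤ Real.exp (-(c * n)) * Fintype.card (Fin (k + 1) → Fin m → Fin k → Fin n × Bool)

/-- **Hypothesis `NearSatWhp k`** (near-satisfiability with high probability at the window density,
with a polynomial rate; a theorem in print — Achlioptas–Peres 2004 Thm 2 gives `Pr[sat] ≥ c_k > 0`
uniformly at density `5·2^k log k/k < 2^k log 2 - O(k)`, and Azuma/McDiarmid concentration of the
1-Lipschitz max-sat value then gives `Pr[no ν-satisfying assignment] ≤ e^{-Ω(ν² m)}` — but NOT in
the tree): for every `ν > 0`, eventually the instances `Φ : Fin m → Fin k → Fin n × Bool` admitting NO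
assignment violating at most `ν m` clauses are at most a `1/(8·k·(m k + 1))` fraction. -/
def NearSatWhp (k : ℕ) : Prop :=
  ∀ ν : ℝ, 0 < ν → ∀ᶠ n : ℕ in Filter.atTop, ∀ m : ℕ, m = ⌊5 * 2 ^ k * Real.log k / k * n⌋₊ →
    (8 * k * (m * k + 1) : ℝ) * ((Finset.univ.filter fun Φ : Fin m → Fin k → Fin n × Bool =>
        ∀ σ : Fin n → Bool, ν * m < ((Finset.univ.filter fun i : Fin m =>
          ∀ j, σ (Φ i j).1 ≠ (Φ i j).2).card : ℝ)).card : ℝ)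
      ≤ Fintype.card (Fin m → Fin k → Fin n × Bool)

/-- **Stability is load-bearing (modulo near-satisfiability)**: if `NearSatWhp k` holds for all
large `k`, then the crux with the stability conjunct deleted is FALSE. Witness: the section
`g Φ :=` some assignment violating `≤ ν m` clauses of `Φ` when one exists. Its event contains every
path all of whose `k(mk+1)` splice-point instances are `ν`-satisfiable; each splice map
`Ψ ↦ P r q` has uniform fibres (`card_filter_splice_mem`), so by the union bound the complement is
at most `k(mk+1) · #Bad · #Inst^k ≤ #paths/8`, whence `#event ≥ (7/8) #paths > e^{-cn} #paths` as
soon as `c n > log 2`. -/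
theorem noStableSection_false_without_consec_of_nearSat
    (H : ∃ k₁ : ℕ, ∀ k ≥ k₁, NearSatWhp k) : ¬ WithoutConsec := by
  classical
  rintro ⟨k₀, h⟩
  obtain ⟨k₁, hH⟩ := H
  set k : ℕ := max k₀ k₁ with hkdef
  obtain ⟨ν, hν, c, hc, hev⟩ := h k (le_max_left _ _)
  have hnear := hH k (le_max_right _ _) ν hν
  have hlog : ∀ᶠ n : ℕ in Filter.atTop, Real.log 2 < c * (n : ℝ) :=
    ((tendsto_natCast_atTop_atTop (R := ℝ)).const_mul_atTop hc).eventually_gt_atTop _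
  obtain ⟨n, hlogn, hevn, hnearn⟩ := (hlog.and (hev.and hnear)).exists
  set α : ℝ := 5 * 2 ^ k * Real.log k / k with hα
  set m : ℕ := ⌊α * n⌋₊ with hm
  -- abbreviations
  set X := (Fin m → Fin k → Fin n × Bool) with hX
  let viol : (Fin n → Bool) → X → ℕ := fun σ Φ =>
    (Finset.univ.filter fun i : Fin m => ∀ j, σ (Φ i j).1 ≠ (Φ i j).2).card
  let sp : (Fin (k + 1) → X) → Fin k → ℕ → X := fun Ψ r q a b =>
    if (a : ℕ) * k + b < q then Ψ r.succ a b else Ψ r.castSucc a b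
  -- the witness section
  let g : X → (Fin n → Bool) := fun Φ =>
    if hΦ : ∃ σ : Fin n → Bool, (viol σ Φ : ℝ) ≤ ν * m then hΦ.choose else fun _ => false
  have hmain := hevn m (by rw [hm, hα]) g
  have hnear' := hnearn m (by rw [hm, hα])
  -- good paths: every splice-point instance is ν-satisfiable
  set Good : Finset (Fin (k + 1) → X) := Finset.univ.filter fun Ψ =>
    ∀ r : Fin k, ∀ q ≤ m * k, ∃ σ : Fin n → Bool, (viol σ (sp Ψ r q) : ℝ) ≤ ν * m with hGood
  set Bad : Finset X := Finset.univ.filter fun Φ => ∀ σ : Fin n → Bool, ν * m < (viol σ Φ : ℝ)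
    with hBad
  set Ev : Finset (Fin (k + 1) → X) := Finset.univ.filter fun Ψ =>
    ∀ r : Fin k, ∀ q ≤ m * k, (viol (g (sp Ψ r q)) (sp Ψ r q) : ℝ) ≤ ν * m with hEv
  -- (1) Good ⊆ event of g
  have h1 : Good ⊆ Ev := by
    intro Ψ hΨ
    rw [hGood, Finset.mem_filter] at hΨ
    rw [hEv, Finset.mem_filter]
    refine ⟨Finset.mem_univ _, fun r q hq => ?_⟩
    have hex := hΨ.2 r q hq
    have hg : g (sp Ψ r q) = hex.choose := by simp only [g, dif_pos hex]
    rw [hg]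
    exact hex.choose_spec
  -- (2) the complement of Good is covered by the bad fibres
  have h2 : (Finset.univ.filter fun Ψ : Fin (k + 1) → X => ¬ (∀ r : Fin k, ∀ q ≤ m * k,
      ∃ σ : Fin n → Bool, (viol σ (sp Ψ r q) : ℝ) ≤ ν * m)) ⊆
      (Finset.univ : Finset (Fin k)).biUnion fun r => (Finset.range (m * k + 1)).biUnion fun q =>
        Finset.univ.filter fun Ψ : Fin (k + 1) → X => sp Ψ r q ∈ Bad := by
    intro Ψ hΨ
    rw [Finset.mem_filter] at hΨ
    obtain ⟨r, q, hq, hbad⟩ : ∃ r : Fin k, ∃ q, q ≤ m * k ∧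
        ¬ ∃ σ : Fin n → Bool, (viol σ (sp Ψ r q) : ℝ) ≤ ν * m := by
      by_contra hcon
      apply hΨ.2
      intro r q hq
      by_contra hno
      exact hcon ⟨r, q, hq, hno⟩
    simp only [Finset.mem_biUnion, Finset.mem_univ, true_and, Finset.mem_range, Finset.mem_filter]
    refine ⟨r, q, Nat.lt_succ_of_le hq, ?_⟩
    rw [hBad, Finset.mem_filter]
    refine ⟨Finset.mem_univ _, fun σ => ?_⟩
    by_contra hle
    exact hbad ⟨σ, not_lt.1 hle⟩
  -- (3) counting
  have hcardX : (Fintype.card (Fin (k + 1) → X) : ℝ) = (Fintype.card X : ℝ) ^ (k + 1) := by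
    rw [Fintype.card_fun, Fintype.card_fin]; push_cast; ring
  have hfib : ∀ (r : Fin k) (q : ℕ), ((Finset.univ.filter fun Ψ : Fin (k + 1) → X =>
      sp Ψ r q ∈ Bad).card : ℝ) = (Bad.card : ℝ) * (Fintype.card X : ℝ) ^ k := by
    intro r q
    exact_mod_cast card_filter_splice_mem r q Bad
  have hcompl : ((Finset.univ.filter fun Ψ : Fin (k + 1) → X => ¬ (∀ r : Fin k, ∀ q ≤ m * k,
      ∃ σ : Fin n → Bool, (viol σ (sp Ψ r q) : ℝ) ≤ ν * m)).card : ℝ) ≤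
      (k * (m * k + 1) : ℝ) * ((Bad.card : ℝ) * (Fintype.card X : ℝ) ^ k) := by
    calc ((Finset.univ.filter fun Ψ : Fin (k + 1) → X => ¬ (∀ r : Fin k, ∀ q ≤ m * k,
            ∃ σ : Fin n → Bool, (viol σ (sp Ψ r q) : ℝ) ≤ ν * m)).card : ℝ)
        ≤ (((Finset.univ : Finset (Fin k)).biUnion fun r => (Finset.range (m * k + 1)).biUnion
            fun q => Finset.univ.filter fun Ψ : Fin (k + 1) → X => sp Ψ r q ∈ Bad).card : ℝ) := by
          exact_mod_cast Finset.card_le_card h2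
      _ ≤ ∑ r : Fin k, (((Finset.range (m * k + 1)).biUnion
            fun q => Finset.univ.filter fun Ψ : Fin (k + 1) → X => sp Ψ r q ∈ Bad).card : ℝ) := by
          exact_mod_cast Finset.card_biUnion_le
      _ ≤ ∑ r : Fin k, ∑ q ∈ Finset.range (m * k + 1),
            ((Finset.univ.filter fun Ψ : Fin (k + 1) → X => sp Ψ r q ∈ Bad).card : ℝ) := by
          refine Finset.sum_le_sum fun r _ => ?_
          exact_mod_cast Finset.card_biUnion_le
      _ = (k * (m * k + 1) : ℝ) * ((Bad.card : ℝ) * (Fintype.card X : ℝ) ^ k) := by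
          simp only [hfib, Finset.sum_const, Finset.card_range, Finset.card_univ, Fintype.card_fin,
            nsmul_eq_mul]
          push_cast
          ring
  have hsplit : (Good.card : ℝ) + ((Finset.univ.filter fun Ψ : Fin (k + 1) → X =>
      ¬ (∀ r : Fin k, ∀ q ≤ m * k, ∃ σ : Fin n → Bool, (viol σ (sp Ψ r q) : ℝ) ≤ ν * m)).card : ℝ)
      = Fintype.card (Fin (k + 1) → X) := by
    rw [hGood]
    exact_mod_cast Finset.card_filter_add_card_filter_not _
  have hEv_le : (Ev.card : ℝ) ≤ Real.exp (-(c * n)) * Fintype.card (Fin (k + 1) → X) := hmain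
  have hGood_le : (Good.card : ℝ) ≤ Ev.card := by exact_mod_cast Finset.card_le_card h1
  -- e^{-cn} < 1/2 and #paths > 0
  have hexp : Real.exp (-(c * n)) < 1 / 2 := by
    have h2 : Real.exp (-Real.log 2) = 1 / 2 := by
      rw [Real.exp_neg, Real.exp_log (by norm_num : (0 : ℝ) < 2), one_div]
    have : Real.exp (-(c * n)) < Real.exp (-Real.log 2) := Real.exp_lt_exp.2 (by linarith)
    rwa [h2] at this
  have hn0 : 0 < n := by
    rcases Nat.eq_zero_or_pos n with h0 | hpos
    · exfalso
      rw [h0, Nat.cast_zero, mul_zero] at hlogn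
      linarith [Real.log_pos (by norm_num : (1 : ℝ) < 2)]
    · exact hpos
  haveI : Nonempty (Fin n) := ⟨⟨0, hn0⟩⟩
  have hXpos : (0 : ℝ) < Fintype.card X := by exact_mod_cast Fintype.card_pos
  have hPpos : (0 : ℝ) < Fintype.card (Fin (k + 1) → X) := by exact_mod_cast Fintype.card_pos
  -- near-satisfiability: 8 k (mk+1) #Bad ≤ #X
  have hB : (8 * k * (m * k + 1) : ℝ) * (Bad.card : ℝ) ≤ Fintype.card X := hnear'
  -- assemble
  have hkey : (k * (m * k + 1) : ℝ) * ((Bad.card : ℝ) * (Fintype.card X : ℝ) ^ k) ≤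
      (Fintype.card (Fin (k + 1) → X) : ℝ) / 8 := by
    rw [hcardX, pow_succ]
    have hXk : (0 : ℝ) ≤ (Fintype.card X : ℝ) ^ k := by positivity
    calc (k * (m * k + 1) : ℝ) * ((Bad.card : ℝ) * (Fintype.card X : ℝ) ^ k)
        = ((8 * k * (m * k + 1) : ℝ) * (Bad.card : ℝ)) / 8 * (Fintype.card X : ℝ) ^ k := by ring
      _ ≤ (Fintype.card X : ℝ) / 8 * (Fintype.card X : ℝ) ^ k :=
          mul_le_mul_of_nonneg_right (by linarith) hXk
      _ = (Fintype.card X : ℝ) ^ k * (Fintype.card X : ℝ) / 8 := by ring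
  nlinarith

end WithoutConsec


/-! ## Line DartGame — audit of the open stub (comments only; nothing to land)

`EnergyBound` (n k Y θ b p₀ …): `1 + k(1 - SB(p₀)) - θ·k(k+1)/2 ≤ energySum Y k / n^k`,
`SB(p) = 2(1-p)^k + kp(1-p)^{k-1}`, `p₀ = (b-2θ)/(-log θ)`, under `b ≤ condEnt Y ℓ` (`1 ≤ ℓ ≤ k`).
Derivation re-checked (I = (I₁,…,I_k) i.i.d. uniform positions; rows `Y₀…Y_k`):
1. `#patterns(I) = 1 + Σ_{ℓ=1}^k 1[Y_ℓ∘I ∉ {Y_0∘I,…,Y_{ℓ-1}∘I}]` — exact.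
2. `P[not new_ℓ] ≤ P[Π_r φ(b_r|ξ_r) > θ] + Σ_{ℓ'<ℓ} P[b = c^{ℓ'} ∧ Π_r φ ≤ θ] ≤ P[Πφ > θ] + ℓθ`:
   conditionally on the prefix patterns `ξ_r` the bits `b_r = Y_ℓ(I_r)` are independent with laws
   `φ(·|ξ_r)` (I_r i.i.d.; conditioning coordinatewise), and a specific pattern of conditional
   probability `≤ θ` is hit with probability `≤ θ`. In the abstract helper `stub_energyRungAbstract`
   the same bound is `#{I ∈ A^k : Πφ(I_r) ≤ θ} ≤ θ·(Σ_{i∈A} φ_i⁻¹)^k ≤ θ n^k` from its hypothesis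
   `Σ_{i : Y_ℓ i = Y_ℓ' i} φ_i⁻¹ ≤ n` (true for conditional frequencies: each prefix class contributes
   exactly `N_ξ` or `0`).
3. `P[Πφ > θ] = P[Σ_r -log φ < L] ≤ P[Σ_r X_r < 1]`, `X = min(-log φ, L)/L ∈ [0,1]`, `L = -log θ`;
   `E X = (condEnt - E(u-L)⁺)/L ≥ (b - 2θ)/L = p₀` since `φ·log(θ/φ) ≤ θ - φ ≤ θ` per (class, bit),
   two bits per class, classes weighted by `N_ξ/n` (abstractly: `Σ_i (u_i - L)⁺ ≤ θ Σ φ_i⁻¹ ≤ 2θn`).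
4. `P[Σ X_r < 1] ≤ E(2 - Σ X_r)⁺ ≤ E(2 - Bin(k, EX))⁺ = SB(EX) ≤ SB(p₀)` (Hoeffding 1963 convex-order
   extremality = the landed `dartGameSmallBall`; `SB` is antitone on `[0,1]`:
   `SB' = -k(1-p)^{k-1} - k(k-1)p(1-p)^{k-2} ≤ 0`), and `0 ≤ p₀ ≤ EX ≤ 1` from `2θ ≤ b`.
5. Summing `ℓθ` over `ℓ = 1..k` gives `θ·k(k+1)/2`. Edge cases: `b > log 2` makes the hypothesis
   unsatisfiable (`condEnt ≤ log 2`), `p₀ < 1` is automatic from `2θ ≤ b ≤ log 2`.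
Numerics (`energy_check.py`, exact enumeration, n ≤ 8, k ≤ 4, 4000 random + hill-climbed
adversarial row families): `min (RHS - LHS) = 1.07` — the bound is very slack at small `k` (it is
an `∀ᶠ k` tool: `SB(2.6/k) → 4.6e^{-2.6} = 0.342`, per-rung free-entropy margin `0.59·log k` at κ = 5,
single bin `[2.6, 2.7]·log k/k`, as the lead's proved `glue_KA` uses). No counterexample regime found.
-/

end Summit.PneNP.PneNP.Cruxes.NoStableSection.Disproof
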